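import Summits.SmoothPoincare4.SmoothPoincare4.Theses.WeylBudget
import Literature.Topology.FourManifolds.GluingProofs
import Literature.Topology.FourManifolds.ClosedBallProofs
import Literature.Geometry.Lorentzian.Isometry
import Literature.Geometry.Lorentzian.IsometryProofs
import Literature.Topology.FourManifolds.GluedMetric
import HarnessLib

/-!
# Stub `stub_isometricTransport` of line `birth` for crux `CorkRegluablePsc`
(item stmt-SmoothPoincare4-3206, route WeylBudget)

**Isometric transport along gluing uniqueness.**  If `X` (with explicit piece embeddings
`kC : C → X`, `kW : W → X` and a Riemannian metric `γ`) and `X'` are both the gluing `C ∪_ψ W`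
of the same compact pieces along the same diffeomorphism `ψ : ∂C ≅ ∂W`, then `X'` carries piece
embeddings `kC', kW'` (again a gluing witness for `ψ`) and a Riemannian metric `γ'` with the SAME
piece metrics, `kC'^* γ' = kC^* γ` and `kW'^* γ' = kW^* γ`.

Proof.  Gluing uniqueness (Hirsch, *Differential Topology* (1976), Ch. 8 §2, Thm. 2.1; the
tree's PROVED `Literature.Topology.FourManifolds.nonempty_diffeomorph_of_isBoundaryGluing_holds`)
gives a diffeomorphism `F : X ≅ X'`.  Push everything forward along `F`: `kC' := F ∘ kC`,
`kW' := F ∘ kW` (smooth embeddings by `Manifold.IsSmoothEmbedding.diffeomorph_comp`; they cover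
`X'` since `F` is onto and meet along the same seam since `F` is one-to-one), and
`γ' := (F⁻¹)^* γ` (`Literature.Geometry.Lorentzian.PseudoRiemannianMetric.comap` along the
diffeomorphism `F⁻¹`, smoothness by `contMDiff_pullbackBilin_holds`; positive definite because
`dF⁻¹` is injective, `injective_mfderiv_diffeomorph_symm`).  The piece metrics are unchanged by the chain rule
(`pullbackBilin_comp`): `(F ∘ kC)^* (F⁻¹)^* γ = kC^* (F^* (F⁻¹)^* γ) = kC^* ((F⁻¹ ∘ F)^* γ) = kC^* γ`
(O'Neill 1983, Ch. 3, p. 58).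

The statement is the registered stub, verbatim from the checked skeleton `Lines/birth.lean`
(namespace `Summit.SmoothPoincare4.SmoothPoincare4.Theorems`).  Everything is proved; no
definitions, no named facts.
-/

noncomputable section

-- the prescribed namespace `Summit.<P>.<Sub>.…` duplicates `SmoothPoincare4` (P = Sub)
set_option linter.dupNamespace false

open scoped Manifold ContDiff Topology

namespace Summit.SmoothPoincare4.SmoothPoincare4.Theorems

open Literature.Topology.FourManifolds Literature.Geometry.Lorentzian
  Literature.Geometry.Lorentzian.PseudoRiemannianMetric

section Pushforward

variable {X : Type} [TopologicalSpace X] [ChartedSpace (EuclideanSpace ℝ (Fin 4)) X]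
  {X' : Type} [TopologicalSpace X'] [ChartedSpace (EuclideanSpace ℝ (Fin 4)) X']

/-- The differential of the inverse of a diffeomorphism is injective at every point
(`dF ∘ dF⁻¹ = id`, chain rule). [folklore] -/
theorem injective_mfderiv_diffeomorph_symm (F : X ≃ₘ⟮𝓡 4, 𝓡 4⟯ X') (y : X') :
    Function.Injective (mfderiv (𝓡 4) (𝓡 4) F.symm y) := fun v w h ↦ by
  have h' := congrArg (mfderiv (𝓡 4) (𝓡 4) F (F.symm y)) h
  rwa [mfderiv_apply_mfderiv_symm F y v, mfderiv_apply_mfderiv_symm F y w] at h'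

/-- **Pulling back along `F` after `F⁻¹` returns the family of forms**: `F^* (F⁻¹)^* b = b`
(chain rule, `F⁻¹ ∘ F = id`). O'Neill 1983, Ch. 3, p. 58. [cite: ONeill1983, Ch. 3, p. 58] -/
theorem pullbackBilin_pullbackBilin_symm (F : X ≃ₘ⟮𝓡 4, 𝓡 4⟯ X')
    (b : Π x : X, TangentSpace (𝓡 4) x →L[ℝ] TangentSpace (𝓡 4) x →L[ℝ] ℝ) :
    pullbackBilin (I := 𝓡 4) (I' := 𝓡 4) F (pullbackBilin (I := 𝓡 4) (I' := 𝓡 4) F.symm b) = b := by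
  have hFmd : MDifferentiable (𝓡 4) (𝓡 4) F := F.contMDiff.mdifferentiable (by simp)
  have hFsmd : MDifferentiable (𝓡 4) (𝓡 4) F.symm := F.symm.contMDiff.mdifferentiable (by simp)
  rw [← pullbackBilin_comp hFsmd hFmd b]
  have hid : ((F.symm : X' → X) ∘ (F : X → X')) = id := funext fun x ↦ F.symm_apply_apply x
  rw [hid, pullbackBilin_id]

/-- **Naturality of piece pullbacks**: for a differentiable map `k : C → X` from a manifold with
boundary and a diffeomorphism `F : X ≅ X'`, `(F ∘ k)^* (F⁻¹)^* b = k^* b`. O'Neill 1983, Ch. 3,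
p. 58. [cite: ONeill1983, Ch. 3, p. 58] -/
theorem pullbackBilin_diffeomorph_comp (F : X ≃ₘ⟮𝓡 4, 𝓡 4⟯ X')
    (b : Π x : X, TangentSpace (𝓡 4) x →L[ℝ] TangentSpace (𝓡 4) x →L[ℝ] ℝ)
    {C : Type} [TopologicalSpace C] [ChartedSpace (EuclideanHalfSpace 4) C] {k : C → X}
    (hk : MDifferentiable (𝓡∂ 4) (𝓡 4) k) (c : C) :
    pullbackBilin (I := 𝓡 4) (I' := 𝓡∂ 4) (F ∘ k) (pullbackBilin (I := 𝓡 4) (I' := 𝓡 4) F.symm b) c =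
      pullbackBilin (I := 𝓡 4) (I' := 𝓡∂ 4) k b c := by
  have hFmd : MDifferentiable (𝓡 4) (𝓡 4) F := F.contMDiff.mdifferentiable (by simp)
  rw [pullbackBilin_comp hFmd hk, pullbackBilin_pullbackBilin_symm]

end Pushforward

/-- **Stub 4 — isometric transport along gluing uniqueness.**
If `X` (with explicit piece embeddings `kC, kW` and a Riemannian metric `γ`) and `X'` are both the gluing
`C ∪_ψ W` of the same compact pieces along the same `ψ : ∂C ≅ ∂W`, then `X'` carries piece embeddings
`kC', kW'` (again a gluing witness for `ψ`) and a Riemannian `γ'` with `kC'^* γ' = kC^* γ`,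
`kW'^* γ' = kW^* γ`.  Proof: `F : X ≅ X'` by gluing uniqueness (Hirsch Ch. 8 Thm. 2.1 =
`Literature.Topology.FourManifolds.nonempty_diffeomorph_of_isBoundaryGluing_holds`, PROVED), `kC' := F ∘ kC`,
`kW' := F ∘ kW`, `γ' := (F.symm)^* γ` (`PseudoRiemannianMetric.comap`), and `pullbackBilin_comp`.
Sources: HirschDT1976 (Ch. 8 §2 Thm. 2.1), BrockerJanich1982 ((13.9)), ONeill1983 (Ch. 3 p. 58).
[cite: HirschDT1976, Ch. 8 §2, Thm. 2.1] [cite: ONeill1983, Ch. 3, p. 58] -/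
theorem stub_isometricTransport :
    ∀ (C : Type) [TopologicalSpace C] [T2Space C] [SecondCountableTopology C]
    [ChartedSpace (EuclideanHalfSpace 4) C] [IsManifold (𝓡∂ 4) ∞ C] [CompactSpace C]
    (bC : Literature.Topology.FourManifolds.BoundaryData (𝓡∂ 4) C (𝓡 3))
    (W : Type) [TopologicalSpace W] [T2Space W] [SecondCountableTopology W]
    [ChartedSpace (EuclideanHalfSpace 4) W] [IsManifold (𝓡∂ 4) ∞ W] [CompactSpace W]
    (bW : Literature.Topology.FourManifolds.BoundaryData (𝓡∂ 4) W (𝓡 3))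
    (ψ : bC.carrier ≃ₘ⟮𝓡 3, 𝓡 3⟯ bW.carrier)
    (X : Type) [TopologicalSpace X] [T2Space X] [SecondCountableTopology X]
    [ChartedSpace (EuclideanSpace ℝ (Fin 4)) X] [IsManifold (𝓡 4) ∞ X]
    (X' : Type) [TopologicalSpace X'] [T2Space X'] [SecondCountableTopology X']
    [ChartedSpace (EuclideanSpace ℝ (Fin 4)) X'] [IsManifold (𝓡 4) ∞ X']
    (kC : C → X) (kW : W → X)
    (γ : Literature.Geometry.Lorentzian.PseudoRiemannianMetric (𝓡 4) ∞ (EuclideanSpace ℝ (Fin 4)) (TangentSpace (𝓡 4) : X → Type _)),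
    Manifold.IsSmoothEmbedding (𝓡∂ 4) (𝓡 4) ∞ kC → Manifold.IsSmoothEmbedding (𝓡∂ 4) (𝓡 4) ∞ kW →
    Set.range kC ∪ Set.range kW = Set.univ →
    (∀ a b, kC a = kW b ↔ ∃ z, a = bC.incl z ∧ b = bW.incl (ψ z)) →
    γ.IsRiemannian →
    Literature.Topology.FourManifolds.IsBoundaryGluing bC bW ψ (𝓡 4) X' →
    ∃ (kC' : C → X') (kW' : W → X')
    (γ' : Literature.Geometry.Lorentzian.PseudoRiemannianMetric (𝓡 4) ∞ (EuclideanSpace ℝ (Fin 4)) (TangentSpace (𝓡 4) : X' → Type _)),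
    Manifold.IsSmoothEmbedding (𝓡∂ 4) (𝓡 4) ∞ kC' ∧ Manifold.IsSmoothEmbedding (𝓡∂ 4) (𝓡 4) ∞ kW' ∧
    Set.range kC' ∪ Set.range kW' = Set.univ ∧
    (∀ a b, kC' a = kW' b ↔ ∃ z, a = bC.incl z ∧ b = bW.incl (ψ z)) ∧
    γ'.IsRiemannian ∧
    (∀ c, Literature.Geometry.Lorentzian.pullbackBilin (I := 𝓡 4) (I' := 𝓡∂ 4) kC' γ'.val c =
    Literature.Geometry.Lorentzian.pullbackBilin (I := 𝓡 4) (I' := 𝓡∂ 4) kC γ.val c) ∧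
    (∀ w, Literature.Geometry.Lorentzian.pullbackBilin (I := 𝓡 4) (I' := 𝓡∂ 4) kW' γ'.val w =
    Literature.Geometry.Lorentzian.pullbackBilin (I := 𝓡 4) (I' := 𝓡∂ 4) kW γ.val w) := by
  intro C _ _ _ _ _ _ bC W _ _ _ _ _ _ bW ψ X _ _ _ _ _ X' _ _ _ _ _ kC kW γ hkC hkW hcov hseam hγ hX'
  -- `X` is the gluing `C ∪_ψ W` too, witnessed by `kC`, `kW`
  have hX : IsBoundaryGluing bC bW ψ (𝓡 4) X := ⟨kC, kW, hkC, hkW, hcov, hseam⟩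
  -- gluing uniqueness: `F : X ≅ X'`
  obtain ⟨F⟩ : Nonempty (X ≃ₘ⟮𝓡 4, 𝓡 4⟯ X') := nonempty_diffeomorph_of_isBoundaryGluing_holds hX hX'
  have hkCmd : MDifferentiable (𝓡∂ 4) (𝓡 4) kC := hkC.contMDiff.mdifferentiable (by simp)
  have hkWmd : MDifferentiable (𝓡∂ 4) (𝓡 4) kW := hkW.contMDiff.mdifferentiable (by simp)
  -- the transported metric `γ' := (F⁻¹)^* γ`
  refine ⟨F ∘ kC, F ∘ kW,
    γ.comap contMDiff_pullbackBilin_holds F.symm F.symm.contMDiff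
      (injective_mfderiv_diffeomorph_symm F) rfl,
    hkC.diffeomorph_comp F, hkW.diffeomorph_comp F, ?_, ?_, ?_,
    pullbackBilin_diffeomorph_comp F γ.val hkCmd, pullbackBilin_diffeomorph_comp F γ.val hkWmd⟩
  · -- the pushed-forward pieces cover `X'` (`F` is onto)
    refine Set.eq_univ_of_forall fun y ↦ ?_
    obtain ⟨x, rfl⟩ := F.surjective y
    have hx : x ∈ Set.range kC ∪ Set.range kW := hcov ▸ Set.mem_univ x
    rcases hx with ⟨a, rfl⟩ | ⟨b, rfl⟩
    · exact Or.inl ⟨a, rfl⟩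
    · exact Or.inr ⟨b, rfl⟩
  · -- and meet along the same seam (`F` is one-to-one)
    intro a b
    rw [← hseam a b]
    exact F.injective.eq_iff
  · -- `γ'` is Riemannian: `γ'(u, u) = γ(dF⁻¹ u, dF⁻¹ u)` and `dF⁻¹` is injective
    intro y u hu
    change 0 < γ.val (F.symm y) (mfderiv (𝓡 4) (𝓡 4) F.symm y u) (mfderiv (𝓡 4) (𝓡 4) F.symm y u)
    refine hγ (F.symm y) _ fun h ↦ hu (injective_mfderiv_diffeomorph_symm F y ?_)
    rw [h, map_zero]

end Summit.SmoothPoincare4.SmoothPoincare4.Theorems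

end
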